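import Summits.CriticalPhenomena.PercolationContinuityZ3.Theorems.PercNearOneGluingNoHeavyQuantCherryCombMixture
import HarnessLib

/-!
# QUANT lane R8, FAR on trees beyond block-combs: THE CHERRY-COMB ROW — FAR at every layer for every block-comb decorated with unit
# cherries and unit two-relay hairs, under the weak hypothesis `EN > 2j` (canonical stemmed model)

builds on p205010 (kernel theorem, internal audit signed; external expert review pending)

Support file (`--supports stmt-CriticalPhenomena-4575`), QUANT lane seat prim-quant-p1 (gen 10); memo
`run/shared/lean/prim/quant/P1-SURPLUS.md` §21.  Theorems only (local notation, no definitions), no sorries, standard axioms.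
Model and notation: `…QuantCherryCombModels.lean`; the mixture step: `…QuantCherryCombMixture.lean` (both this seat).  Base case: THE
BLOCK-COMB ROW `Quant.BlockComb.tail_ge_of_le_marg_of_mean` (`…QuantBlockCombRow.lean`, p1 g9; independently census-1 g13's
`Quant.BlockComb.tail_ge_of_mean`).

* `Quant.CherryComb.tail_ge_of_noLeaf` — with no leaves (`st = id`) the stemmed tail is the block-comb tail and the block-comb row applies.
* `Quant.CherryComb.sum_congr_off_three` — bookkeeping: two sums over `κ` agreeing off three pieces and on the total of those three.
* **`Quant.CherryComb.tail_ge_of_cherryComb` — THE CHERRY-COMB ROW.**  Chain gates and private gates in `[0,1]`; stems are stemless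
  (`st (st k) = st k`) and sit at the level of their leaves (`lv (st k) = lv k`); every leaf `k` (`st k ≠ k`) belongs to a UNIT CHERRY (its
  stem has size `0` and exactly one other leaf `k'`, of the same size as `k`); live levels `≤ D`; `x` at most every live marginal
  `(∏_{i<lv k} q i)·g k` (blob) resp. `(∏_{i<lv k} q i)·g (st k)·g k` (leaf); and `2j < EN = Σ_k a k · marginal k`.  Then
  `x ≤ TAILst = P(N ≥ j+1)`.  PROOF: induction on the number of leaves.  None: `tail_ge_of_noLeaf`.  Otherwise pick a leaf `ℓ₁`, its stem
  `s₀` and its partner `ℓ₂` and apply `min_tail_detach_glue_le_tail`: the detached model `U` (leaves become independent blobs on gates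
  `g s₀·g ℓ_r`) and the glued model `G` (the cherry becomes one blob of size `2m` on gate `g s₀·(g ℓ₁ + g ℓ₂)/2`) both have two leaves fewer,
  the SAME mean and live marginals `≥ x` (the glued gate is the average of two gates whose marginals are `≥ x`), so by induction both tails
  are `≥ x`, hence so is the cherry-comb's.
In tree language (gate coordinates / route vocabulary: the follow-up files of this seat) this is FAR at every layer — the conclusion of
`Quant.FarTreeRow` — for every rooted tree whose side structures off the distinguished chain are glued blocks, unit two-relay hairs (`m` relays
on one gate, `m` more below them on a further gate) and unit cherries (a relay-free vertex carrying two classes of `m` relays each), in any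
number and at any levels: the first family with randomness inside the side branches (LEAD-NOTES-G14 N25 (1) 'block-comb + one two-relay
hair at the root' is its smallest member).  NOT covered (the blob mixture is not universal, census-1 GENERAL-ROW-G13 §7 (T5)): hairs and
cherries with UNEQUAL class sizes, side subtrees with three or more relay classes.
[this work]; mixture principle: prim-quant-census-1 GENERAL-ROW-G13 §7 (T4) (this lane); product weights [cite: Grimmett1999, §1.3 p. 10].
-/

namespace Summit.CriticalPhenomena.PercolationContinuityZ3.Theorems

namespace Quant

namespace CherryComb

open Finset

variable {κ : Type*} [Fintype κ] [DecidableEq κ]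

/-- product-Bernoulli weight of the set `S` of open pieces -/
local notation3 "wt[" g ", " S "]" => ∏ k, (if k ∈ (S : Finset κ) then (g : κ → ℝ) k else 1 - (g : κ → ℝ) k)

/-- probability that the chain `q` of length `D` is open exactly to depth `i` -/
local notation3 "pd[" D ", " q ", " i "]" =>
  (∏ i' ∈ Finset.range (i : ℕ), (q : ℕ → ℝ) i') * (if (i : ℕ) < (D : ℕ) then 1 - (q : ℕ → ℝ) i else 1)

/-- mass counted at depth `i` in blob configuration `S` (block-comb model) -/
local notation3 "mass[" lv ", " a ", " i ", " S "]" =>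
  ∑ k ∈ (S : Finset κ).filter (fun k => (lv : κ → ℕ) k ≤ (i : ℕ)), ((a : κ → ℕ) k : ℕ)

/-- the block-comb tail `P(N ≥ j+1)` -/
local notation3 "TAIL[" D ", " q ", " lv ", " a ", " g ", " j "]" =>
  ∑ i ∈ Finset.range ((D : ℕ) + 1), pd[D, q, i] *
    ∑ S : Finset κ, wt[g, S] * (if (j : ℕ) + 1 ≤ mass[lv, a, i, S] then (1 : ℝ) else 0)

/-- mass counted at depth `i` in configuration `S` of the STEMMED model: piece `k` counts when `lv k ≤ i`, `k ∈ S` and `st k ∈ S` -/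
local notation3 "massSt[" lv ", " a ", " st ", " i ", " S "]" =>
  ∑ k ∈ (S : Finset κ).filter (fun k => (lv : κ → ℕ) k ≤ (i : ℕ) ∧ (st : κ → κ) k ∈ (S : Finset κ)), ((a : κ → ℕ) k : ℕ)

/-- the stemmed tail `P(N ≥ j+1)` -/
local notation3 "TAILst[" D ", " q ", " lv ", " a ", " g ", " st ", " j "]" =>
  ∑ i ∈ Finset.range ((D : ℕ) + 1), pd[D, q, i] *
    ∑ S : Finset κ, wt[g, S] * (if (j : ℕ) + 1 ≤ massSt[lv, a, st, i, S] then (1 : ℝ) else 0)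

/-! ### 1. Base case and bookkeeping -/

/-- **No leaves.**  If `st = id` then `TAILst = TAIL` and the block-comb row `Quant.BlockComb.tail_ge_of_le_marg_of_mean` applies. [this work] -/
theorem tail_ge_of_noLeaf (D : ℕ) (q : ℕ → ℝ) (hq : ∀ i, 0 ≤ q i ∧ q i ≤ 1) (lv : κ → ℕ) (a : κ → ℕ) (g : κ → ℝ)
    (hg : ∀ k, 0 ≤ g k ∧ g k ≤ 1) (st : κ → κ) (hall : ∀ k, st k = k) (j : ℕ) (hlv : ∀ k, 0 < a k → lv k ≤ D) (x : ℝ)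
    (hx : ∀ k, 0 < a k → x ≤ (∏ i ∈ Finset.range (lv k), q i) * (if st k = k then g k else g (st k) * g k))
    (hmean : (2 * j : ℝ) < ∑ k, (a k : ℝ) * ((∏ i ∈ Finset.range (lv k), q i) * (if st k = k then g k else g (st k) * g k))) :
    x ≤ TAILst[D, q, lv, a, g, st, j] := by
  have hT : TAILst[D, q, lv, a, g, st, j] = TAIL[D, q, lv, a, g, j] := by
    refine Finset.sum_congr rfl fun i _ => ?_
    congr 1
    refine Finset.sum_congr rfl fun S _ => ?_
    rw [massSt_eq_mass lv a st hall i S]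
  rw [hT]
  refine BlockComb.tail_ge_of_le_marg_of_mean D q hq lv a g hg j hlv x (fun k hk => ?_) ?_
  · have := hx k hk; rwa [if_pos (hall k)] at this
  · refine hmean.trans_le (le_of_eq (Finset.sum_congr rfl fun k _ => by rw [if_pos (hall k)]))

omit [DecidableEq κ] in
/-- Two sums over `κ` agree if the summands agree off three distinct pieces and the three exceptional summands have the same total. -/
theorem sum_congr_off_three (f f' : κ → ℝ) (k₁ k₂ k₃ : κ) (h12 : k₁ ≠ k₂) (h13 : k₁ ≠ k₃) (h23 : k₂ ≠ k₃)
    (hoff : ∀ k, k ≠ k₁ → k ≠ k₂ → k ≠ k₃ → f' k = f k) (h3 : f' k₁ + f' k₂ + f' k₃ = f k₁ + f k₂ + f k₃) :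
    ∑ k, f' k = ∑ k, f k := by
  classical
  have m2 : k₂ ∈ (Finset.univ : Finset κ).erase k₁ := Finset.mem_erase.2 ⟨h12.symm, Finset.mem_univ _⟩
  have m3 : k₃ ∈ ((Finset.univ : Finset κ).erase k₁).erase k₂ :=
    Finset.mem_erase.2 ⟨h23.symm, Finset.mem_erase.2 ⟨h13.symm, Finset.mem_univ _⟩⟩
  have hS : ∀ h : κ → ℝ, ∑ k, h k = h k₁ + h k₂ + h k₃ + ∑ k ∈ (((Finset.univ : Finset κ).erase k₁).erase k₂).erase k₃, h k := by
    intro h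
    rw [← Finset.add_sum_erase _ _ (Finset.mem_univ k₁), ← Finset.add_sum_erase _ _ m2, ← Finset.add_sum_erase _ _ m3]
    ring
  rw [hS f', hS f, h3, Finset.sum_congr rfl fun k hk => hoff k ?_ ?_ ?_]
  · exact fun h => by simp [h] at hk
  · exact fun h => by simp [h] at hk
  · exact fun h => by simp [h] at hk

/-! ### 2. The cherry-comb row -/

/-- The cherry-comb row, by induction on (a bound `n` for) the number of leaves. [this work] -/
theorem tail_ge_of_cherryComb_aux (D : ℕ) (q : ℕ → ℝ) (hq : ∀ i, 0 ≤ q i ∧ q i ≤ 1) (lv : κ → ℕ) (j : ℕ) (x : ℝ) :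
    ∀ (n : ℕ) (a : κ → ℕ) (g : κ → ℝ) (st : κ → κ),
      (Finset.univ.filter fun k => st k ≠ k).card ≤ n →
      (∀ k, 0 ≤ g k ∧ g k ≤ 1) → (∀ k, st (st k) = st k) → (∀ k, lv (st k) = lv k) →
      (∀ k, st k ≠ k → a (st k) = 0 ∧ ∃ k', k' ≠ k ∧ k' ≠ st k ∧ st k' = st k ∧ a k' = a k ∧
        ∀ k'', st k'' = st k → k'' = st k ∨ k'' = k ∨ k'' = k') →
      (∀ k, 0 < a k → lv k ≤ D) →
      (∀ k, 0 < a k → x ≤ (∏ i ∈ Finset.range (lv k), q i) * (if st k = k then g k else g (st k) * g k)) →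
      (2 * j : ℝ) < ∑ k, (a k : ℝ) * ((∏ i ∈ Finset.range (lv k), q i) * (if st k = k then g k else g (st k) * g k)) →
      x ≤ TAILst[D, q, lv, a, g, st, j] := by
  intro n
  induction n with
  | zero =>
    intro a g st hcard hg _ _ _ hlv hx hmean
    have hall : ∀ k, st k = k := by
      intro k
      by_contra h
      have hk : k ∈ Finset.univ.filter fun k => st k ≠ k := Finset.mem_filter.2 ⟨Finset.mem_univ _, h⟩
      have := Finset.card_pos.2 ⟨k, hk⟩
      omega
    exact tail_ge_of_noLeaf D q hq lv a g hg st hall j hlv x hx hmean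
  | succ n ih =>
    intro a g st hcard hg hstem hlvst hcherry hlv hx hmean
    by_cases hall : ∀ k, st k = k
    · exact tail_ge_of_noLeaf D q hq lv a g hg st hall j hlv x hx hmean
    push Not at hall
    obtain ⟨ℓ₁, hℓ₁⟩ := hall
    obtain ⟨s₀, hst1⟩ : ∃ s₀, st ℓ₁ = s₀ := ⟨_, rfl⟩
    obtain ⟨ha0, ℓ₂, h21, h2s, hst2, ha21, hfib⟩ := hcherry ℓ₁ hℓ₁
    rw [hst1] at ha0 h2s hst2 hfib
    obtain ⟨m, ha1⟩ : ∃ m, a ℓ₁ = m := ⟨_, rfl⟩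
    have ha2 : a ℓ₂ = m := ha21.trans ha1
    have h12 : ℓ₁ ≠ ℓ₂ := h21.symm
    have h1 : s₀ ≠ ℓ₁ := fun h => hℓ₁ (hst1.trans h)
    have h2 : s₀ ≠ ℓ₂ := h2s.symm
    have hst0 : st s₀ = s₀ := by rw [← hst1]; exact hstem ℓ₁
    have hnl1 : ∀ k, st k ≠ ℓ₁ := fun k h => by
      have := hstem k; rw [h] at this; exact hℓ₁ this
    have hnl2 : ∀ k, st k ≠ ℓ₂ := fun k h => by
      have := hstem k; rw [h, hst2] at this; exact h2 this
    have hlv1 : lv ℓ₁ = lv s₀ := by rw [← hst1]; exact (hlvst ℓ₁).symm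
    have hlv2 : lv ℓ₂ = lv s₀ := by rw [← hst2]; exact (hlvst ℓ₂).symm
    have hg0 := hg s₀
    have hg1 := hg ℓ₁
    have hg2 := hg ℓ₂
    -- a piece off the cherry has its stem off the cherry
    have hoff : ∀ k, k ≠ ℓ₁ → k ≠ ℓ₂ → k ≠ s₀ → st k ≠ s₀ := by
      intro k hk1 hk2 hk0 h
      rcases hfib k h with h' | h' | h'
      · exact hk0 h'
      · exact hk1 h'
      · exact hk2 h'
    -- the mixture step
    have hstep := min_tail_detach_glue_le_tail D q lv a g st s₀ ℓ₁ ℓ₂ m h12 h1 h2 hst0 hst1 hst2 hfib hnl1 hnl2 ha0 ha1 ha2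
      hlv1 hlv2 hg0 hg1 hg2 j
    refine le_trans (le_min ?_ ?_) hstep
    all_goals
      obtain ⟨hstU1, hstU2, hstU0, hstUo, -, -, -⟩ := detach_facts st s₀ ℓ₁ ℓ₂ h12 h1 h2 hst0 hfib hnl1 hnl2
      set stU := Function.update (Function.update st ℓ₁ ℓ₁) ℓ₂ ℓ₂ with hstU
      -- the detached stem map: two leaves fewer, stems stemless, levels kept
      have hcardU : (Finset.univ.filter fun k => stU k ≠ k).card ≤ n := by
        have hsub : (Finset.univ.filter fun k => stU k ≠ k) ⊆ (Finset.univ.filter fun k => st k ≠ k).erase ℓ₁ := by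
          intro k hk
          rw [Finset.mem_filter] at hk
          have hk1 : k ≠ ℓ₁ := fun h => hk.2 (by rw [h, hstU1])
          have hk2 : k ≠ ℓ₂ := fun h => hk.2 (by rw [h, hstU2])
          rw [Finset.mem_erase, Finset.mem_filter]
          exact ⟨hk1, Finset.mem_univ _, by rw [← hstUo k hk1 hk2]; exact hk.2⟩
        have hmem : ℓ₁ ∈ Finset.univ.filter (fun k => st k ≠ k) := Finset.mem_filter.2 ⟨Finset.mem_univ _, hℓ₁⟩
        have h' := Finset.card_le_card hsub
        rw [Finset.card_erase_of_mem hmem] at h'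
        omega
      have hstemU : ∀ k, stU (stU k) = stU k := by
        intro k
        by_cases hk1 : k = ℓ₁
        · rw [hk1, hstU1, hstU1]
        by_cases hk2 : k = ℓ₂
        · rw [hk2, hstU2, hstU2]
        rw [hstUo k hk1 hk2, hstUo (st k) (hnl1 k) (hnl2 k), hstem k]
      have hlvstU : ∀ k, lv (stU k) = lv k := by
        intro k
        by_cases hk1 : k = ℓ₁
        · rw [hk1, hstU1]
        by_cases hk2 : k = ℓ₂
        · rw [hk2, hstU2]
        rw [hstUo k hk1 hk2]; exact hlvst k
      -- a leaf of the detached model is a leaf of an untouched cherry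
      have hleafU : ∀ k, stU k ≠ k → k ≠ ℓ₁ ∧ k ≠ ℓ₂ ∧ k ≠ s₀ ∧ stU k = st k ∧ st k ≠ k ∧ st k ≠ s₀ ∧
          ∃ k', k' ≠ k ∧ k' ≠ st k ∧ st k' = st k ∧ a k' = a k ∧ k' ≠ ℓ₁ ∧ k' ≠ ℓ₂ ∧ k' ≠ s₀ ∧ a (st k) = 0 ∧
            ∀ k'', stU k'' = stU k → k'' = stU k ∨ k'' = k ∨ k'' = k' := by
        intro k hk
        have hk1 : k ≠ ℓ₁ := fun h => hk (by rw [h, hstU1])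
        have hk2 : k ≠ ℓ₂ := fun h => hk (by rw [h, hstU2])
        have hsk : stU k = st k := hstUo k hk1 hk2
        have hstk : st k ≠ k := fun h => hk (by rw [hsk, h])
        have hk0 : k ≠ s₀ := fun h => hstk (by rw [h, hst0])
        have hsk0 : st k ≠ s₀ := hoff k hk1 hk2 hk0
        obtain ⟨ha0', k', hk'k, hk's, hst', ha', hfib'⟩ := hcherry k hstk
        have hk'1 : k' ≠ ℓ₁ := fun h => hsk0 (by rw [← hst', h, hst1])
        have hk'2 : k' ≠ ℓ₂ := fun h => hsk0 (by rw [← hst', h, hst2])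
        have hk'0 : k' ≠ s₀ := fun h => hsk0 (by rw [← hst', h, hst0])
        refine ⟨hk1, hk2, hk0, hsk, hstk, hsk0, k', hk'k, hk's, hst', ha', hk'1, hk'2, hk'0, ha0', fun k'' hk'' => ?_⟩
        rw [hsk] at hk'' ⊢
        have hk''1 : k'' ≠ ℓ₁ := fun h => hnl1 k (by rw [← hk'', h, hstU1])
        have hk''2 : k'' ≠ ℓ₂ := fun h => hnl2 k (by rw [← hk'', h, hstU2])
        rw [hstUo k'' hk''1 hk''2] at hk''
        exact hfib' k'' hk''
    · -- model `U`: the leaves detached as independent blobs on gates `g s₀·g ℓ₁`, `g s₀·g ℓ₂`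
      set gU := Function.update (Function.update g ℓ₁ (g s₀ * g ℓ₁)) ℓ₂ (g s₀ * g ℓ₂) with hgU
      have hgU1 : gU ℓ₁ = g s₀ * g ℓ₁ := by rw [hgU, Function.update_of_ne h12, Function.update_self]
      have hgU2 : gU ℓ₂ = g s₀ * g ℓ₂ := by rw [hgU, Function.update_self]
      have hgUo : ∀ k, k ≠ ℓ₁ → k ≠ ℓ₂ → gU k = g k := fun k hk1 hk2 => by
        rw [hgU, Function.update_of_ne hk2, Function.update_of_ne hk1]
      have hgU' : ∀ k, 0 ≤ gU k ∧ gU k ≤ 1 := by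
        intro k
        by_cases hk1 : k = ℓ₁
        · rw [hk1, hgU1]; exact ⟨mul_nonneg hg0.1 hg1.1, mul_le_one₀ hg0.2 hg1.1 hg1.2⟩
        by_cases hk2 : k = ℓ₂
        · rw [hk2, hgU2]; exact ⟨mul_nonneg hg0.1 hg2.1, mul_le_one₀ hg0.2 hg2.1 hg2.2⟩
        rw [hgUo k hk1 hk2]; exact hg k
      -- the effective gates are unchanged
      have hfac : ∀ k, (if stU k = k then gU k else gU (stU k) * gU k) = (if st k = k then g k else g (st k) * g k) := by
        intro k
        by_cases hk1 : k = ℓ₁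
        · rw [hk1, if_pos hstU1, if_neg (fun h => hℓ₁ h), hgU1, hst1]
        by_cases hk2 : k = ℓ₂
        · rw [hk2, if_pos hstU2, if_neg (fun h => h2 (hst2.symm.trans h)), hgU2, hst2]
        rw [hstUo k hk1 hk2, hgUo k hk1 hk2]
        by_cases hsk : st k = k
        · rw [if_pos hsk, if_pos hsk]
        · rw [if_neg hsk, if_neg hsk, hgUo (st k) (hnl1 k) (hnl2 k)]
      refine ih a gU stU hcardU hgU' hstemU hlvstU (fun k hk => ?_) hlv (fun k hk => by rw [hfac k]; exact hx k hk)
        (by rw [Finset.sum_congr rfl fun k _ => by rw [hfac k]]; exact hmean)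
      obtain ⟨-, -, -, hsk, -, -, k', hk'k, hk's, hst', ha', hk'1, hk'2, -, ha0', hfib'⟩ := hleafU k hk
      exact ⟨by rw [hsk]; exact ha0', k', hk'k, by rw [hsk]; exact hk's, by rw [hstUo k' hk'1 hk'2, hst', hsk], ha', hfib'⟩
    · -- model `G`: the cherry glued into one blob of size `2m` on gate `g s₀·(g ℓ₁ + g ℓ₂)/2`
      set aG := Function.update (Function.update (Function.update a s₀ (2 * m)) ℓ₁ 0) ℓ₂ 0 with haG
      set gG := Function.update g s₀ (g s₀ * (g ℓ₁ + g ℓ₂) / 2) with hgG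
      have hgG0 : gG s₀ = g s₀ * (g ℓ₁ + g ℓ₂) / 2 := by rw [hgG, Function.update_self]
      have hgGo : ∀ k, k ≠ s₀ → gG k = g k := fun k hk => by rw [hgG, Function.update_of_ne hk]
      have haG0 : aG s₀ = 2 * m := by rw [haG, Function.update_of_ne h2, Function.update_of_ne h1, Function.update_self]
      have haG1 : aG ℓ₁ = 0 := by rw [haG, Function.update_of_ne h12, Function.update_self]
      have haG2 : aG ℓ₂ = 0 := by rw [haG, Function.update_self]
      have haGo : ∀ k, k ≠ ℓ₁ → k ≠ ℓ₂ → k ≠ s₀ → aG k = a k := fun k hk1 hk2 hk0 => by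
        rw [haG, Function.update_of_ne hk2, Function.update_of_ne hk1, Function.update_of_ne hk0]
      have hgG' : ∀ k, 0 ≤ gG k ∧ gG k ≤ 1 := by
        intro k
        by_cases hk0 : k = s₀
        · rw [hk0, hgG0]
          exact ⟨by nlinarith [hg0.1, hg1.1, hg2.1], by nlinarith [hg0.1, hg0.2, hg1.2, hg2.2, hg1.1, hg2.1]⟩
        rw [hgGo k hk0]; exact hg k
      -- the effective gates off the cherry are unchanged
      have hfac : ∀ k, k ≠ ℓ₁ → k ≠ ℓ₂ → k ≠ s₀ →
          (if stU k = k then gG k else gG (stU k) * gG k) = (if st k = k then g k else g (st k) * g k) := by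
        intro k hk1 hk2 hk0
        rw [hstUo k hk1 hk2, hgGo k hk0]
        by_cases hsk : st k = k
        · rw [if_pos hsk, if_pos hsk]
        · rw [if_neg hsk, if_neg hsk, hgGo (st k) (hoff k hk1 hk2 hk0)]
      have hm_of : 0 < aG s₀ → 0 < m := fun h => by rw [haG0] at h; omega
      refine ih aG gG stU hcardU hgG' hstemU hlvstU (fun k hk => ?_) (fun k hk => ?_) (fun k hk => ?_) ?_
      · obtain ⟨hk1, hk2, hk0, hsk, -, hsk0, k', hk'k, hk's, hst', ha', hk'1, hk'2, hk'0, ha0', hfib'⟩ := hleafU k hk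
        refine ⟨by rw [hsk, haGo (st k) (hnl1 k) (hnl2 k) hsk0]; exact ha0', k', hk'k, by rw [hsk]; exact hk's,
          by rw [hstUo k' hk'1 hk'2, hst', hsk], by rw [haGo k' hk'1 hk'2 hk'0, haGo k hk1 hk2 hk0]; exact ha', hfib'⟩
      · -- live levels
        by_cases hk1 : k = ℓ₁
        · rw [hk1, haG1] at hk; exact absurd hk (lt_irrefl 0)
        by_cases hk2 : k = ℓ₂
        · rw [hk2, haG2] at hk; exact absurd hk (lt_irrefl 0)
        by_cases hk0 : k = s₀
        · rw [hk0] at hk ⊢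
          rw [← hlv1]
          exact hlv ℓ₁ (by rw [ha1]; exact hm_of hk)
        rw [haGo k hk1 hk2 hk0] at hk
        exact hlv k hk
      · -- the floor: the glued gate is the average of two gates with marginal `≥ x`
        by_cases hk1 : k = ℓ₁
        · rw [hk1, haG1] at hk; exact absurd hk (lt_irrefl 0)
        by_cases hk2 : k = ℓ₂
        · rw [hk2, haG2] at hk; exact absurd hk (lt_irrefl 0)
        by_cases hk0 : k = s₀
        · rw [hk0] at hk ⊢
          have hm := hm_of hk
          have hx1 := hx ℓ₁ (by rw [ha1]; exact hm)
          rw [if_neg hℓ₁, hst1, hlv1] at hx1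
          have hx2 := hx ℓ₂ (by rw [ha2]; exact hm)
          rw [if_neg (fun h => h2 (hst2.symm.trans h)), hst2, hlv2] at hx2
          rw [if_pos hstU0, hgG0]
          have e : (∏ i ∈ Finset.range (lv s₀), q i) * (g s₀ * (g ℓ₁ + g ℓ₂) / 2) =
              ((∏ i ∈ Finset.range (lv s₀), q i) * (g s₀ * g ℓ₁) + (∏ i ∈ Finset.range (lv s₀), q i) * (g s₀ * g ℓ₂)) / 2 := by
            ring
          rw [e]
          linarith
        rw [hfac k hk1 hk2 hk0]
        rw [haGo k hk1 hk2 hk0] at hk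
        exact hx k hk
      · -- the mean is unchanged
        have hsum : (∑ k, (aG k : ℝ) * ((∏ i ∈ Finset.range (lv k), q i) * (if stU k = k then gG k else gG (stU k) * gG k))) =
            ∑ k, (a k : ℝ) * ((∏ i ∈ Finset.range (lv k), q i) * (if st k = k then g k else g (st k) * g k)) := by
          refine sum_congr_off_three _ _ ℓ₁ ℓ₂ s₀ h12 h1.symm h2.symm (fun k hk1 hk2 hk0 => ?_) ?_
          · rw [haGo k hk1 hk2 hk0, hfac k hk1 hk2 hk0]
          · rw [haG1, haG2, haG0, if_pos hstU0, hgG0, ha1, ha2, ha0, if_neg hℓ₁, if_neg (fun h => h2 (hst2.symm.trans h)), hst1,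
              hst2, hlv1, hlv2]
            push_cast
            ring
        rw [hsum]
        exact hmean

/-- **THEOREM (THE CHERRY-COMB ROW: FAR at every layer for every block-comb decorated with unit cherries / unit two-relay hairs, under
`EN > 2j`; canonical stemmed model).**  Chain gates `q i ∈ [0,1]`, private gates `g k ∈ [0,1]`, stems stemless (`st (st k) = st k`) and at the
level of their leaves (`lv (st k) = lv k`); every leaf `k` (`st k ≠ k`) lies in a unit cherry: its stem has size `0` and exactly one further leaf
`k' ≠ k`, with `a k' = a k`; live levels `≤ D`; `x ≤` every live marginal (`(∏_{i<lv k} q i)·g k` for a blob, `(∏_{i<lv k} q i)·g (st k)·g k`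
for a leaf); `2j < Σ_k a k·marginal k`.  Then `x ≤ TAILst[D, q, lv, a, g, st, j] = P(N ≥ j+1)`. [this work] -/
theorem tail_ge_of_cherryComb (D : ℕ) (q : ℕ → ℝ) (hq : ∀ i, 0 ≤ q i ∧ q i ≤ 1) (lv : κ → ℕ) (a : κ → ℕ) (g : κ → ℝ)
    (hg : ∀ k, 0 ≤ g k ∧ g k ≤ 1) (st : κ → κ) (hstem : ∀ k, st (st k) = st k) (hlvst : ∀ k, lv (st k) = lv k)
    (hcherry : ∀ k, st k ≠ k → a (st k) = 0 ∧ ∃ k', k' ≠ k ∧ k' ≠ st k ∧ st k' = st k ∧ a k' = a k ∧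
      ∀ k'', st k'' = st k → k'' = st k ∨ k'' = k ∨ k'' = k')
    (j : ℕ) (hlv : ∀ k, 0 < a k → lv k ≤ D) (x : ℝ)
    (hx : ∀ k, 0 < a k → x ≤ (∏ i ∈ Finset.range (lv k), q i) * (if st k = k then g k else g (st k) * g k))
    (hmean : (2 * j : ℝ) < ∑ k, (a k : ℝ) * ((∏ i ∈ Finset.range (lv k), q i) * (if st k = k then g k else g (st k) * g k))) :
    x ≤ TAILst[D, q, lv, a, g, st, j] :=
  tail_ge_of_cherryComb_aux D q hq lv j x _ a g st le_rfl hg hstem hlvst hcherry hlv hx hmean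

end CherryComb

end Quant

end Summit.CriticalPhenomena.PercolationContinuityZ3.Theorems
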